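import Summits.CriticalPhenomena.CardyFormulaZ2.Theorems.CardyFlipRussoCoveringLegRobustDefs
import Literature.Probability.Percolation.QuadCrossingSquareModel
import HarnessLib

/-!
# Preliminaries for the blocking stub of line `five-arm-null` (skeleton v5): coordinates in a square model

Crux `Summit.CriticalPhenomena.CardyFormulaZ2.Theses.CardyFlipRusso.CoveringLeg` (stmt-CriticalPhenomena-6435), line
`five-arm-null`, registered stub `stub_blocking_of_planar : Sig.stub_blockingOfPlanar` (lead c5).  Continuum preliminaries:
a square model `Φ` of the conformal rectangle `R` (`exists_isSquareModel`: a plane homeomorphism taking the model square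
`(-1, 1)²` onto `Ω = R.carrier` and side `k` onto `R.arc k`) converts metric statements near `∂Ω` into coordinate statements near
the sides of the square:

* `block_chart_apply_mem`, `block_chart_arc` — square points are drawn in `Ω`, arc points come from sides;
* `block_far_side` — a point `m`-far from `R.arc k` pulls back `η`-far from side `k` (`η` a uniform-continuity modulus of `Φ`);
* `block_band_of_square`, `block_band_of_near_side` — such points, when in the square or near a lateral side, have
  `|im| ≤ 1 − 2ν` (`η = 4ν`);
* `block_re_ge_of_cap`, `block_re_le_of_cap` — a point of an end cap of the upper comparison quad (an arc whose `r`-fattening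
  misses `Ω`) pulls back to the right of `re = 1 + η_r/2`, resp. to the left of `re = −1 − η_r/2`.

References: B. Bollobás, O. Riordan, *Percolation* (2006), Ch. 7 Claim 19 p. 192 [BollobasRiordan2006]; O. Schramm,
S. Smirnov, Ann. Probab. 39 (2011), proof of Lemma 5.1 (square models) [SchrammSmirnov2011].
-/

noncomputable section

namespace Summit.CriticalPhenomena.CardyFormulaZ2.Cruxes.CoveringLeg.FiveArmNull

open Set Metric
open Literature.Probability.RandomPlanarGeometry Literature.Probability.Percolation

/-! ### Pulling back by a square model -/

/-- A point of the model square is drawn in `Ω`. [cite: SchrammSmirnov2011, §5 (proof of Lemma 5.1)] -/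
theorem block_chart_apply_mem {R : ConformalRectangle} {Φ : ℂ ≃ₜ ℂ} (hΦ : IsSquareModel R Φ) {z : ℂ}
    (hre : z.re ∈ Ioo (-1 : ℝ) 1) (him : z.im ∈ Ioo (-1 : ℝ) 1) : Φ z ∈ R.carrier := by
  rw [← hΦ.image_carrier]
  refine mem_image_of_mem _ ?_
  rw [unitSquareQuad_carrier, Complex.mem_reProdIm]
  exact ⟨hre, him⟩

/-- An arc point is the image of a side point. [cite: SchrammSmirnov2011, §5 (proof of Lemma 5.1)] -/
theorem block_chart_arc {R : ConformalRectangle} {Φ : ℂ ≃ₜ ℂ} (hΦ : IsSquareModel R Φ) (k : Fin 4) {q : ℂ}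
    (hq : q ∈ R.arc k) : ∃ z ∈ unitSquareQuad.arc k, Φ z = q := by
  rw [← hΦ.image_arc k] at hq
  exact hq

/-- The sides of the model square lie in the box `[-2, 2]²`, with coordinates in `[-1, 1]`. [folklore] -/
theorem block_side_coord {k : Fin 4} {z : ℂ} (hz : z ∈ unitSquareQuad.arc k) :
    z.re ∈ Icc (-1 : ℝ) 1 ∧ z.im ∈ Icc (-1 : ℝ) 1 := by
  fin_cases k
  · obtain ⟨h1, h2⟩ := SquareModel.mem_arc_zero.1 hz
    exact ⟨h2, by rw [h1]; exact ⟨le_rfl, by norm_num⟩⟩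
  · obtain ⟨h1, h2⟩ := SquareModel.mem_arc_one.1 hz
    exact ⟨by rw [h1]; exact ⟨by norm_num, le_rfl⟩, h2⟩
  · obtain ⟨h1, h2⟩ := SquareModel.mem_arc_two.1 hz
    exact ⟨h2, by rw [h1]; exact ⟨by norm_num, le_rfl⟩⟩
  · obtain ⟨h1, h2⟩ := SquareModel.mem_arc_three.1 hz
    exact ⟨by rw [h1]; exact ⟨le_rfl, by norm_num⟩, h2⟩

/-- Side points are in the box. [folklore] -/
theorem block_side_mem_box {k : Fin 4} {z : ℂ} (hz : z ∈ unitSquareQuad.arc k) : z ∈ Icc (-2 : ℝ) 2 ×ℂ Icc (-2 : ℝ) 2 := by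
  obtain ⟨⟨h1, h2⟩, h3, h4⟩ := block_side_coord hz
  exact Complex.mem_reProdIm.2 ⟨⟨by linarith, by linarith⟩, by linarith, by linarith⟩

/-- **Far from an arc ⇒ far from the side.**  If `Φ` moves `η`-close points of the box `m`-close, a point `p` with
`Φ⁻¹ p` in the box and `m ≤ infDist p (R.arc k)` has `Φ⁻¹ p` at distance `≥ η` from every point of side `k`. [folklore] -/
theorem block_far_side {R : ConformalRectangle} {Φ : ℂ ≃ₜ ℂ} (hΦ : IsSquareModel R Φ) {η m : ℝ}
    (huc : ∀ z ∈ Icc (-2 : ℝ) 2 ×ℂ Icc (-2 : ℝ) 2, ∀ z' ∈ Icc (-2 : ℝ) 2 ×ℂ Icc (-2 : ℝ) 2,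
      dist z z' < η → dist (Φ z) (Φ z') < m)
    (k : Fin 4) {p : ℂ} (hpB : Φ.symm p ∈ Icc (-2 : ℝ) 2 ×ℂ Icc (-2 : ℝ) 2) (hfar : m ≤ infDist p (R.arc k)) :
    ∀ z ∈ unitSquareQuad.arc k, η ≤ dist (Φ.symm p) z := by
  intro z hz
  by_contra hlt
  push Not at hlt
  have h1 := huc _ hpB z (block_side_mem_box hz) hlt
  rw [Homeomorph.apply_symm_apply] at h1
  have hzk : Φ z ∈ R.arc k := by rw [← hΦ.image_arc k]; exact mem_image_of_mem _ hz
  exact absurd (hfar.trans (infDist_le_dist_of_mem hzk)) (not_le.2 h1)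

/-! ### Coordinate consequences -/

/-- **Band bound inside the square**: a point of the open square which is `4ν`-far from the bottom and top sides has
`|im| ≤ 1 − 2ν`. [folklore] -/
theorem block_band_of_square {w : ℂ} {ν : ℝ} (hν : 0 ≤ ν) (hre : w.re ∈ Ioo (-1 : ℝ) 1) (him : w.im ∈ Ioo (-1 : ℝ) 1)
    (h0 : ∀ z ∈ unitSquareQuad.arc 0, 4 * ν ≤ dist w z) (h2 : ∀ z ∈ unitSquareQuad.arc 2, 4 * ν ≤ dist w z) :
    -(1 - 2 * ν) ≤ w.im ∧ w.im ≤ 1 - 2 * ν := by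
  have hreI : w.re ∈ Icc (-1 : ℝ) 1 := ⟨hre.1.le, hre.2.le⟩
  constructor
  · have hz : (⟨w.re, -1⟩ : ℂ) ∈ unitSquareQuad.arc 0 := SquareModel.mem_arc_zero.2 ⟨rfl, hreI⟩
    have hd := h0 _ hz
    have : dist w ⟨w.re, -1⟩ = |w.im - (-1)| := by
      rw [Complex.dist_eq, Complex.norm_def, Complex.normSq_apply]
      simp only [Complex.sub_re, Complex.sub_im, sub_self, mul_zero, zero_add]
      exact Real.sqrt_mul_self_eq_abs _
    rw [this, abs_of_pos (by linarith [him.1])] at hd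
    linarith
  · have hz : (⟨w.re, 1⟩ : ℂ) ∈ unitSquareQuad.arc 2 := SquareModel.mem_arc_two.2 ⟨rfl, hreI⟩
    have hd := h2 _ hz
    have : dist w ⟨w.re, 1⟩ = |w.im - 1| := by
      rw [Complex.dist_eq, Complex.norm_def, Complex.normSq_apply]
      simp only [Complex.sub_re, Complex.sub_im, sub_self, mul_zero, zero_add]
      exact Real.sqrt_mul_self_eq_abs _
    rw [this, abs_of_neg (by linarith [him.2])] at hd
    linarith

/-- **Band bound near a lateral side**: a point within `ν ≤ 1/4` of a point of side `1` or side `3` which is `4ν`-far from the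
bottom and top sides has `|im| ≤ 1 − 2ν`, and lies in the box. [folklore] -/
theorem block_band_of_near_side {w z : ℂ} {ν : ℝ} (hν : 0 < ν) (hν4 : ν ≤ 1 / 4)
    (hz : z ∈ unitSquareQuad.arc 1 ∨ z ∈ unitSquareQuad.arc 3) (hwz : dist w z ≤ ν)
    (h0 : ∀ z ∈ unitSquareQuad.arc 0, 4 * ν ≤ dist w z) (h2 : ∀ z ∈ unitSquareQuad.arc 2, 4 * ν ≤ dist w z) :
    (-(1 - 2 * ν) ≤ w.im ∧ w.im ≤ 1 - 2 * ν) ∧ w ∈ Icc (-2 : ℝ) 2 ×ℂ Icc (-2 : ℝ) 2 := by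
  have hcoord : ∀ w z : ℂ, dist w z ≤ |w.re - z.re| + |w.im - z.im| := fun w z => by
    rw [Complex.dist_eq, ← Complex.sub_re, ← Complex.sub_im]; exact Complex.norm_le_abs_re_add_abs_im _
  have hzc : (z.re = 1 ∨ z.re = -1) ∧ z.im ∈ Icc (-1 : ℝ) 1 := by
    rcases hz with hz | hz
    · obtain ⟨h1, h2⟩ := SquareModel.mem_arc_one.1 hz; exact ⟨Or.inl h1, h2⟩
    · obtain ⟨h1, h2⟩ := SquareModel.mem_arc_three.1 hz; exact ⟨Or.inr h1, h2⟩
  obtain ⟨e1, e2, e3, e4⟩ : z.re - ν ≤ w.re ∧ w.re ≤ z.re + ν ∧ z.im - ν ≤ w.im ∧ w.im ≤ z.im + ν := by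
    rw [Complex.dist_eq] at hwz
    have a1 := (Complex.abs_re_le_norm (w - z)).trans hwz
    have a2 := (Complex.abs_im_le_norm (w - z)).trans hwz
    rw [Complex.sub_re, abs_le] at a1
    rw [Complex.sub_im, abs_le] at a2
    exact ⟨by linarith [a1.1], by linarith [a1.2], by linarith [a2.1], by linarith [a2.2]⟩
  -- a point of `[-1, 1]` within `ν` of `w.re`
  set x : ℝ := max (-1) (min w.re 1) with hx
  have hxI : x ∈ Icc (-1 : ℝ) 1 := ⟨le_max_left _ _, max_le (by norm_num) (min_le_right _ _)⟩
  have hxw : |w.re - x| ≤ ν := by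
    rcases hzc.1 with h | h
    · -- near `re = 1`
      have : x = min w.re 1 := max_eq_right (le_min (by linarith) (by norm_num))
      rw [this]
      rcases le_or_gt w.re 1 with h' | h'
      · rw [min_eq_left h', sub_self, abs_zero]; exact hν.le
      · rw [min_eq_right h'.le, abs_of_pos (by linarith)]; linarith
    · -- near `re = -1`
      rcases le_or_gt w.re (-1) with h' | h'
      · have : x = -1 := by
          rw [hx, min_eq_left (by linarith : w.re ≤ 1)]; exact max_eq_left h'
        rw [this, abs_of_nonpos (by linarith)]; linarith
      · have : x = w.re := by
          rw [hx, min_eq_left (by linarith : w.re ≤ 1)]; exact max_eq_right h'.le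
        rw [this, sub_self, abs_zero]; exact hν.le
  refine ⟨⟨?_, ?_⟩, ?_⟩
  · by_contra hlt
    push Not at hlt
    have hz0 : (⟨x, -1⟩ : ℂ) ∈ unitSquareQuad.arc 0 := SquareModel.mem_arc_zero.2 ⟨rfl, hxI⟩
    have hd := (h0 _ hz0).trans (hcoord w ⟨x, -1⟩)
    have : |w.im - (-1)| ≤ 2 * ν := abs_le.2 ⟨by linarith [hzc.2.1], by linarith⟩
    change 4 * ν ≤ |w.re - x| + |w.im - (-1)| at hd
    linarith
  · by_contra hlt
    push Not at hlt
    have hz2 : (⟨x, 1⟩ : ℂ) ∈ unitSquareQuad.arc 2 := SquareModel.mem_arc_two.2 ⟨rfl, hxI⟩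
    have hd := (h2 _ hz2).trans (hcoord w ⟨x, 1⟩)
    have : |w.im - 1| ≤ 2 * ν := abs_le.2 ⟨by linarith, by linarith [hzc.2.2]⟩
    change 4 * ν ≤ |w.re - x| + |w.im - 1| at hd
    linarith
  · have hr1 : -1 ≤ z.re ∧ z.re ≤ 1 := by rcases hzc.1 with h | h <;> rw [h] <;> norm_num
    exact Complex.mem_reProdIm.2 ⟨⟨by linarith, by linarith⟩, by linarith [hzc.2.1], by linarith [hzc.2.2]⟩

/-! ### The end caps of the upper quad pull back beyond the lateral sides -/

/-- **A cap point pulls back to the right of `re = 1 + η/2`.**  Let `Φ` move `η`-close points of the box `r`-close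
(`η ≤ 1`), and let `q` be a point whose `r`-neighbourhood misses `Ω` (a point of the cap of the upper quad beyond `arc 1`), with
`w = Φ⁻¹ q` in the box, `−1 < w.re` and `|w.im| < 1`.  Then `1 + η/2 ≤ w.re` (first `1 ≤ w.re`, as otherwise `w` is in the
open square and `q = Φ w ∈ Ω`; then the square point `(1 − η/4, w.im)` is `η`-close to `w`, so drawn `r`-close to `q`, hence
off `Ω` — but it is drawn in `Ω`). [cite: BollobasRiordan2006, Ch. 7 p. 186] -/
theorem block_re_ge_of_cap {R : ConformalRectangle} {Φ : ℂ ≃ₜ ℂ} (hΦ : IsSquareModel R Φ) {η r : ℝ} (hη : 0 < η)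
    (hη1 : η ≤ 1) (hr : 0 < r)
    (huc : ∀ z ∈ Icc (-2 : ℝ) 2 ×ℂ Icc (-2 : ℝ) 2, ∀ z' ∈ Icc (-2 : ℝ) 2 ×ℂ Icc (-2 : ℝ) 2,
      dist z z' < η → dist (Φ z) (Φ z') < r)
    {q : ℂ} (hcap : ∀ y : ℂ, dist y q < r → y ∉ R.carrier) (hwB : Φ.symm q ∈ Icc (-2 : ℝ) 2 ×ℂ Icc (-2 : ℝ) 2)
    (hre : -1 < (Φ.symm q).re) (him : (Φ.symm q).im ∈ Ioo (-1 : ℝ) 1) : 1 + η / 2 ≤ (Φ.symm q).re := by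
  have hcoord : ∀ w z : ℂ, dist w z ≤ |w.re - z.re| + |w.im - z.im| := fun w z => by
    rw [Complex.dist_eq, ← Complex.sub_re, ← Complex.sub_im]; exact Complex.norm_le_abs_re_add_abs_im _
  set w := Φ.symm q with hw
  -- first `1 ≤ w.re`: otherwise `w` is in the open square and `q = Φ w ∈ Ω`
  have h1 : 1 ≤ w.re := by
    by_contra hlt
    push Not at hlt
    have : Φ w ∈ R.carrier := block_chart_apply_mem hΦ ⟨hre, hlt⟩ him
    rw [hw, Homeomorph.apply_symm_apply] at this
    exact hcap q (by rw [dist_self]; exact hr) this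
  by_contra hlt
  push Not at hlt
  -- the square point `z* = (1 - η/4, w.im)` is `η`-close to `w`, so `Φ z*` is `r`-close to `q`, hence off `Ω`; but it is in `Ω`
  set zs : ℂ := ⟨1 - η / 4, w.im⟩ with hzs
  have hzs_sq : Φ zs ∈ R.carrier :=
    block_chart_apply_mem hΦ (z := zs) ⟨by change -1 < 1 - η / 4; linarith, by change 1 - η / 4 < 1; linarith⟩ him
  have hzsB : zs ∈ Icc (-2 : ℝ) 2 ×ℂ Icc (-2 : ℝ) 2 :=
    Complex.mem_reProdIm.2 ⟨⟨by change -2 ≤ 1 - η / 4; linarith, by change 1 - η / 4 ≤ 2; linarith⟩,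
      by change -2 ≤ w.im; linarith [him.1], by change w.im ≤ 2; linarith [him.2]⟩
  have hd : dist zs w < η := by
    refine (hcoord zs w).trans_lt ?_
    have e1 : |zs.re - w.re| < η := by
      change |1 - η / 4 - w.re| < η
      rw [abs_of_neg (by linarith)]; linarith
    have e2 : |zs.im - w.im| = 0 := by change |w.im - w.im| = 0; rw [sub_self, abs_zero]
    linarith
  have h2 := huc zs hzsB w hwB hd
  rw [hw, Homeomorph.apply_symm_apply] at h2
  exact hcap _ h2 hzs_sq

/-- **A cap point pulls back to the left of `re = −1 − η/2`** (the mirror image of `block_re_ge_of_cap`, for the cap of the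
upper quad beyond `arc 3`). [cite: BollobasRiordan2006, Ch. 7 p. 186] -/
theorem block_re_le_of_cap {R : ConformalRectangle} {Φ : ℂ ≃ₜ ℂ} (hΦ : IsSquareModel R Φ) {η r : ℝ} (hη : 0 < η)
    (hη1 : η ≤ 1) (hr : 0 < r)
    (huc : ∀ z ∈ Icc (-2 : ℝ) 2 ×ℂ Icc (-2 : ℝ) 2, ∀ z' ∈ Icc (-2 : ℝ) 2 ×ℂ Icc (-2 : ℝ) 2,
      dist z z' < η → dist (Φ z) (Φ z') < r)
    {q : ℂ} (hcap : ∀ y : ℂ, dist y q < r → y ∉ R.carrier) (hwB : Φ.symm q ∈ Icc (-2 : ℝ) 2 ×ℂ Icc (-2 : ℝ) 2)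
    (hre : (Φ.symm q).re < 1) (him : (Φ.symm q).im ∈ Ioo (-1 : ℝ) 1) : (Φ.symm q).re ≤ -1 - η / 2 := by
  have hcoord : ∀ w z : ℂ, dist w z ≤ |w.re - z.re| + |w.im - z.im| := fun w z => by
    rw [Complex.dist_eq, ← Complex.sub_re, ← Complex.sub_im]; exact Complex.norm_le_abs_re_add_abs_im _
  set w := Φ.symm q with hw
  -- first `w.re ≤ -1`: otherwise `w` is in the open square and `q = Φ w ∈ Ω`
  have h1 : w.re ≤ -1 := by
    by_contra hlt
    push Not at hlt
    have : Φ w ∈ R.carrier := block_chart_apply_mem hΦ ⟨hlt, hre⟩ him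
    rw [hw, Homeomorph.apply_symm_apply] at this
    exact hcap q (by rw [dist_self]; exact hr) this
  by_contra hlt
  push Not at hlt
  -- the square point `z* = (-1 + η/4, w.im)` is `η`-close to `w`, so `Φ z*` is `r`-close to `q`, hence off `Ω`; but it is in `Ω`
  set zs : ℂ := ⟨-1 + η / 4, w.im⟩ with hzs
  have hzs_sq : Φ zs ∈ R.carrier :=
    block_chart_apply_mem hΦ (z := zs) ⟨by change -1 < -1 + η / 4; linarith, by change -1 + η / 4 < 1; linarith⟩ him
  have hzsB : zs ∈ Icc (-2 : ℝ) 2 ×ℂ Icc (-2 : ℝ) 2 :=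
    Complex.mem_reProdIm.2 ⟨⟨by change -2 ≤ -1 + η / 4; linarith, by change -1 + η / 4 ≤ 2; linarith⟩,
      by change -2 ≤ w.im; linarith [him.1], by change w.im ≤ 2; linarith [him.2]⟩
  have hd : dist zs w < η := by
    refine (hcoord zs w).trans_lt ?_
    have e1 : |zs.re - w.re| < η := by
      change |-1 + η / 4 - w.re| < η
      rw [abs_of_pos (by linarith)]; linarith
    have e2 : |zs.im - w.im| = 0 := by change |w.im - w.im| = 0; rw [sub_self, abs_zero]
    linarith
  have h2 := huc zs hzsB w hwB hd
  rw [hw, Homeomorph.apply_symm_apply] at h2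
  exact hcap _ h2 hzs_sq

/-! ### Uniform continuity of the inverse chart near the closed quad -/

/-- The closed quad is compact (it is the image of the closed model square). [folklore] -/
theorem block_isCompact_closure {R : ConformalRectangle} {Φ : ℂ ≃ₜ ℂ} (hΦ : IsSquareModel R Φ) :
    IsCompact (closure R.carrier) := by
  rw [← hΦ.image_Icc]
  exact (isCompact_Icc.reProdIm isCompact_Icc).image Φ.continuous

/-- **Uniform continuity of `Φ⁻¹` near the closed quad** (Heine–Cantor on the `1`-fattening of `closure Ω`): for `ε > 0`
there is `θ ∈ (0, 1]` such that `dist (Φ⁻¹ x) (Φ⁻¹ y) < ε` whenever `y ∈ closure Ω` and `dist x y < θ`. [folklore] -/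
theorem block_symm_uc {R : ConformalRectangle} {Φ : ℂ ≃ₜ ℂ} (hΦ : IsSquareModel R Φ) {ε : ℝ} (hε : 0 < ε) :
    ∃ θ : ℝ, 0 < θ ∧ θ ≤ 1 ∧ ∀ x y : ℂ, y ∈ closure R.carrier → dist x y < θ →
      dist (Φ.symm x) (Φ.symm y) < ε := by
  have hK : IsCompact (cthickening 1 (closure R.carrier)) := (block_isCompact_closure hΦ).cthickening
  obtain ⟨θ, hθ, h⟩ := Metric.uniformContinuousOn_iff.1
    (hK.uniformContinuousOn_of_continuous Φ.symm.continuous.continuousOn) ε hε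
  refine ⟨min θ 1, lt_min hθ one_pos, min_le_right _ _, fun x y hy hxy => ?_⟩
  have hx : x ∈ cthickening 1 (closure R.carrier) :=
    mem_cthickening_of_dist_le x y 1 _ hy (hxy.le.trans (min_le_right _ _))
  exact h x hx y (self_subset_cthickening _ hy) (hxy.trans_le (min_le_left _ _))

/-- **Near an arc ⇒ pulled back near the side**: if `Φ⁻¹` moves `θ`-close pairs (second point in `closure Ω`) `ε`-close and
`infDist p (R.arc k) ≤ t < θ`, then `Φ⁻¹ p` is within `ε` of a point of side `k` of the model square. [folklore] -/
theorem block_near_side {R : ConformalRectangle} {Φ : ℂ ≃ₜ ℂ} (hΦ : IsSquareModel R Φ) {θ ε : ℝ}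
    (hθuc : ∀ x y : ℂ, y ∈ closure R.carrier → dist x y < θ → dist (Φ.symm x) (Φ.symm y) < ε)
    (k : Fin 4) {p : ℂ} {t : ℝ} (hpt : infDist p (R.arc k) ≤ t) (htθ : t < θ) :
    ∃ z ∈ unitSquareQuad.arc k, dist (Φ.symm p) z < ε := by
  obtain ⟨q, hq, hpq⟩ := (R.isCompact_arc k).exists_infDist_eq_dist ⟨_, R.pt_mem_arc_self k⟩ p
  obtain ⟨z, hz, rfl⟩ := block_chart_arc hΦ k hq
  refine ⟨z, hz, ?_⟩
  have hqc : Φ z ∈ closure R.carrier := frontier_subset_closure (R.arc_subset_frontier k hq)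
  have h := hθuc p (Φ z) hqc (by rw [← hpq]; exact hpt.trans_lt htθ)
  rwa [Homeomorph.symm_apply_apply] at h

/-- **Near a point of `Ω` ⇒ pulled back near the open square**: if `Φ⁻¹` moves `θ`-close pairs `ε`-close, `y ∈ Ω` and
`dist x y < θ`, then `|re (Φ⁻¹ x)| < 1 + ε`. [folklore] -/
theorem block_near_carrier {R : ConformalRectangle} {Φ : ℂ ≃ₜ ℂ} (hΦ : IsSquareModel R Φ) {θ ε : ℝ}
    (hθuc : ∀ x y : ℂ, y ∈ closure R.carrier → dist x y < θ → dist (Φ.symm x) (Φ.symm y) < ε)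
    {x y : ℂ} (hy : y ∈ R.carrier) (hxy : dist x y < θ) : |(Φ.symm x).re| < 1 + ε := by
  have h := hθuc x y (subset_closure hy) hxy
  obtain ⟨hre, -⟩ : (Φ.symm y).re ∈ Ioo (-1 : ℝ) 1 ∧ (Φ.symm y).im ∈ Ioo (-1 : ℝ) 1 := by
    rw [← hΦ.image_carrier] at hy
    obtain ⟨z, hz, rfl⟩ := hy
    rw [Homeomorph.symm_apply_apply]
    rwa [unitSquareQuad_carrier, Complex.mem_reProdIm] at hz
  have h1 : |(Φ.symm x).re - (Φ.symm y).re| < ε := by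
    rw [← Complex.sub_re]
    exact (Complex.abs_re_le_norm _).trans_lt (by rwa [← Complex.dist_eq])
  rw [abs_lt] at h1 ⊢
  exact ⟨by linarith [hre.1, h1.1], by linarith [hre.2, h1.2]⟩

/-! ### Registered sub-goal of the blocking stub (closed form) -/

/-- **Registered sub-goal `block_symmUC_holds`** (closed form of `block_symm_uc`, the continuum-side input of
`stub_blocking_of_planar`): the inverse of a square model of `R` is uniformly continuous near the closed quad, with a
modulus `θ ≤ 1`. [cite: SchrammSmirnov2011, §5 (proof of Lemma 5.1)] -/
theorem block_symmUC_holds : ∀ (R : Literature.Probability.RandomPlanarGeometry.ConformalRectangle) (Φ : ℂ ≃ₜ ℂ), Literature.Probability.Percolation.IsSquareModel R Φ → ∀ ε : ℝ, 0 < ε → ∃ θ : ℝ, 0 < θ ∧ θ ≤ 1 ∧ ∀ x y : ℂ, y ∈ closure R.carrier → dist x y < θ → dist (Φ.symm x) (Φ.symm y) < ε :=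
  fun _ _ hΦ _ hε => block_symm_uc hΦ hε

end Summit.CriticalPhenomena.CardyFormulaZ2.Cruxes.CoveringLeg.FiveArmNull

end
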